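import Mathlib
import Literature.Computability.AlgebraicComplexity.DepthThreeRankBound
import Literature.GroupTheory.QuasirandomGroups.AlternatingProductMixing
import Summits.ValiantsHypothesis.ValiantsHypothesis.Theorems.MonotoneRestorationOrbitRestorationQPLevelStructureB
import Summits.ValiantsHypothesis.ValiantsHypothesis.Theorems.MonotoneRestorationMixingScaleDefs
import Summits.ValiantsHypothesis.ValiantsHypothesis.Theorems.MonotoneRestorationMixingScaleLevelMatchingData
import HarnessLib

/-!
# M2 of the line `mixing-scale`: EVERY TERM IS ALMOST INVARIANT under the even row/column renamings (ORBIT currency)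

Route MonotoneRestoration, crux `OrbitRestorationQP` (stmt-ValiantsHypothesis-18293), line `mixing-scale` (val-idea-12, skeleton
`Cruxes/OrbitRestorationQP/Lines/mixing_scale.lean`), registered stub **M2**
`stub_almostInvariantTerms : AlternatingMixing → depthThree_rankBound → AlmostInvariantTerms` — THE LEVER of the line — landed here BY
NAME in namespace `Summit.ValiantsHypothesis.ValiantsHypothesis.Theorems.OrbitRestorationQPMixingScale` over the Theorems-side
vocabulary `…MixingScaleDefs.lean`, with the mixing hypothesis spelled by its LANDED Literature name
`Literature.GroupTheory.QuasirandomGroups.alternatingProductMixing` (p600358; token for token the skeleton's local `AlternatingMixing`: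
Nikolov–Pyber 2011 Cor. 2 / Gowers 2008 Thm 3.3 for `𝔄_n`, minimal degree `n − 1`) — cited by name, never restated.

THE ARGUMENT (Theorems-side port of the PROVED sections `Derisk` and `M2` of the skeleton, rev 6, authored by val-idea-12; FACT A is the
landed `LevelRep.exists_rdist_act_le`).  Let `Φ : Sym_n → Aut` be a homomorphism acting by degree-preserving automorphisms fixing `f`
(rows: `vact rowHom`; columns: `vact colHom`), `R` a clean minimal representation with `m` terms, `m³ + 2 ≤ n`, `n > 8`, and `i` a term.
FACT A gives for every `g` a partner `J g` with `rdist (L i) (act (Φ g) (L (J g))) ≤ Rb`; pigeonhole on `g ↦ (J g, sign g)` (`2m` values,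
`2m ∣ n!`) gives a fibre `P` of size `≥ n!/(2m)` with constant partner `j` and constant sign; `Z := g₀⁻¹ P ⊆ 𝔄_n` has the same size and
lies inside `E_j(2Rb) := {z : rdist (L j) (act (Φ z) (L j)) ≤ 2Rb}` (invariance `rdist_act` + triangle inequality through `L i`).  Since
`(n!/2)³ = m³ N³ < (n − 1) N³ ≤ (n − 1)|Z|³` (`N = n!/(2m)`), PRODUCT MIXING writes every even `ρ'` as `x y z` with `x, y, z ∈ Z`, so
`rdist (L j) (act (Φ ρ') (L j)) ≤ 6Rb` (subadditivity `selfDist_mul_le`); transporting to `i` along the edge `L i ~ act (Φ g₀) (L j)`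
(`selfDist_conj_le`, `ρ = g₀ (g₀⁻¹ ρ g₀) g₀⁻¹`) gives `≤ Rb + 6Rb + Rb = 8Rb` for every even `ρ` (`almostInv_of_hom`).  Rows and columns
commute (`mact_eq_row_mul_col`), so `rdist (L i) (act (mact σ τ) (L i)) ≤ 16·Rb ≤ 28·Rb` for even `σ, τ`.

* `act_mul`, `act_one`, `selfDist_mul_le`, `selfDist_inv`, `selfDist_conj_le` — the `E(t)` calculus of `act` on normalised multisets;
* `two_mul_dvd_factorial`, `almostInv_of_hom`, `mact_eq_row_mul_col`;
* `stub_almostInvariantTerms` — **M2**, the registered signature with the Literature name of the mixing fact.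

Proved modulo the two NAMED FACTS entering BY NAME as hypotheses of the stub (exactly as registered): `alternatingProductMixing`
(Gowers / Nikolov–Pyber, UNPROVED in the tree) and `depthThree_rankBound` (Saxena–Seshadhri 2013 Thm 5, UNPROVED in the tree).  Honest
framing: M2 is one M-sized input of the line; M4b/M4c/M5 and the rung `ProductDepthRestorationQP (fun _ => 1)` stay OPEN; nothing here
bears on VP ≠ VNP. [cite: Gowers2008, Thm 3.3; NikolovPyber2011, Cor. 2; KarninShpilka2009, §3; SaxenaSeshadhri2013, Theorem 5]
-/

noncomputable section

open MvPolynomial Equiv Literature.Computability.AlgebraicComplexity Literature.GroupTheory.QuasirandomGroups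

-- `Summit.ValiantsHypothesis.ValiantsHypothesis.…` is the tree's single-conjunct layout (Sub = Summit).
set_option linter.dupNamespace false

namespace Summit.ValiantsHypothesis.ValiantsHypothesis.Theorems.OrbitRestorationQPMixingScale

open RankDistance LevelRep LevelStructure ProductAction ClusterMatching

/-! ### The `E(t) := {φ : rdist L (act φ L) ≤ t}` calculus: `act` is an action on normalised multisets, self-displacement is
subadditive (`E(s)·E(t) ⊆ E(s+t)`), inversion-symmetric (`E(t)⁻¹ = E(t)`), and transports along a matching edge. -/
section Derisk

variable {K : Type} [Field K] {V : Type} [DecidableEq (MvPolynomial V K)]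

omit [DecidableEq (MvPolynomial V K)] in
/-- `act` is an action: acting by `φ * ψ` is acting by `ψ` then by `φ`. [folklore] -/
theorem act_mul (φ ψ : MvPolynomial V K ≃ₐ[K] MvPolynomial V K) (L : Multiset (MvPolynomial V K)) :
    act (φ * ψ) L = act φ (act ψ L) := by
  have h : act ψ L = (L.map fun q => ψ q).map nrm := by rw [act, Multiset.map_map]; rfl
  rw [h, LevelStructure.act_map_nrm, act, act, Multiset.map_map]
  rfl

omit [DecidableEq (MvPolynomial V K)] in
/-- `act 1` fixes normalised multisets. [folklore] -/
theorem act_one {L : Multiset (MvPolynomial V K)} (hL : IsNormalised L) :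
    act (1 : MvPolynomial V K ≃ₐ[K] MvPolynomial V K) L = L := by
  rw [act]
  conv_rhs => rw [← Multiset.map_id L]
  exact Multiset.map_congr rfl fun q hq => by simpa using hL q hq

/-- **Self-displacement is subadditive**: `E(s)·E(t) ⊆ E(s+t)`. [folklore] -/
theorem selfDist_mul_le (φ ψ : MvPolynomial V K ≃ₐ[K] MvPolynomial V K) {L : Multiset (MvPolynomial V K)}
    (hL : IsNormalised L) :
    rdist L (act (φ * ψ) L) ≤ rdist L (act φ L) + rdist L (act ψ L) := by
  calc rdist L (act (φ * ψ) L) ≤ rdist L (act φ L) + rdist (act φ L) (act (φ * ψ) L) := rdist_triangle _ _ _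
    _ = rdist L (act φ L) + rdist L (act ψ L) := by rw [act_mul, rdist_act φ hL (isNormalised_act ψ L)]

/-- **Self-displacement is symmetric under inversion**: `E(t)⁻¹ = E(t)`. [folklore] -/
theorem selfDist_inv (φ : MvPolynomial V K ≃ₐ[K] MvPolynomial V K) {L : Multiset (MvPolynomial V K)}
    (hL : IsNormalised L) : rdist L (act φ⁻¹ L) = rdist L (act φ L) := by
  have h := rdist_act φ hL (isNormalised_act φ⁻¹ L)
  rw [← act_mul, mul_inv_cancel, act_one hL, rdist_comm] at h
  exact h.symm

/-- **Transport along a matching edge**: if `L'` is within `r` of `act φ L` and `act ρ` moves `L` by at most `t`, then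
`act (φ ρ φ⁻¹)` moves `L'` by at most `r + t + r`. [folklore] -/
theorem selfDist_conj_le (φ ρ : MvPolynomial V K ≃ₐ[K] MvPolynomial V K) {L L' : Multiset (MvPolynomial V K)}
    (hL : IsNormalised L) (hL' : IsNormalised L') :
    rdist L' (act (φ * ρ * φ⁻¹) L') ≤ rdist L' (act φ L) + rdist L (act ρ L) + rdist L' (act φ L) := by
  have h1 : rdist (act φ L) (act (φ * ρ) L) = rdist L (act ρ L) := by
    rw [act_mul, rdist_act φ hL (isNormalised_act ρ L)]
  have h2 : rdist (act (φ * ρ) L) (act (φ * ρ * φ⁻¹) L') = rdist L' (act φ L) := by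
    have h := rdist_act (φ * ρ * φ⁻¹) (isNormalised_act φ L) hL'
    rw [← act_mul, show φ * ρ * φ⁻¹ * φ = φ * ρ by group] at h
    rw [h, rdist_comm]
  calc rdist L' (act (φ * ρ * φ⁻¹) L')
      ≤ rdist L' (act (φ * ρ) L) + rdist (act (φ * ρ) L) (act (φ * ρ * φ⁻¹) L') := rdist_triangle _ _ _
    _ ≤ (rdist L' (act φ L) + rdist (act φ L) (act (φ * ρ) L)) + rdist (act (φ * ρ) L) (act (φ * ρ * φ⁻¹) L') :=
        Nat.add_le_add_right (rdist_triangle _ _ _) _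
    _ = rdist L' (act φ L) + rdist L (act ρ L) + rdist L' (act φ L) := by rw [h1, h2]

end Derisk

/-! ### M2: the popularity set of the FACT-A matching, mixing in `𝔄_n`, transport -/
section M2

/-- `2m ∣ n!` for `1 ≤ m ≤ n`, `4 ≤ n`. [folklore] -/
theorem two_mul_dvd_factorial {m n : ℕ} (hm1 : 1 ≤ m) (hmn : m ≤ n) (hn : 4 ≤ n) : 2 * m ∣ Nat.factorial n := by
  rcases Nat.lt_or_ge m 3 with h | h
  · interval_cases m
    · simpa using Nat.dvd_factorial (by norm_num : 0 < 2) (by omega : 2 ≤ n)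
    · simpa using Nat.dvd_factorial (by norm_num : 0 < 4) hn
  · refine dvd_trans ?_ (Nat.factorial_dvd_factorial hmn)
    obtain ⟨k, rfl⟩ : ∃ k, m = k + 1 := ⟨m - 1, by omega⟩
    rw [Nat.factorial_succ, mul_comm 2 (k + 1)]
    exact mul_dvd_mul_left (k + 1) (Nat.dvd_factorial (by norm_num : 0 < 2) (by omega : 2 ≤ k))

variable {n : ℕ}

/-- **ALMOST-INVARIANCE UNDER ONE QUASIRANDOM COORDINATE ACTION.**  If a homomorphism `Φ : Sym_n → Aut` acts by degree-preserving
automorphisms fixing `f`, then every term of a clean representation of `f` with `m³ + 2 ≤ n` terms (`n > 8`) is moved by at most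
`8·Rb` in rank distance by every EVEN `ρ`: popularity set of the rank-bound matching (density `≥ 1/2m` with a fixed sign) ⇒ a subset
`Z ⊆ 𝔄_n` of density `≥ 1/m` inside `E_j(2Rb)` ⇒ `Z·Z·Z = 𝔄_n ⊆ E_j(6Rb)` by product mixing ⇒ transport to `i`.  Granting product mixing
in `𝔄_n` and the Saxena–Seshadhri rank bound (both BY NAME). [cite: Gowers2008, Thm 3.3; NikolovPyber2011, Cor. 2; SaxenaSeshadhri2013,
Theorem 5] -/
theorem almostInv_of_hom (hmix : alternatingProductMixing) (hRB : depthThree_rankBound) {D : ℕ}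
    {f : MvPolynomial (Fin n × Fin n) ℂ} (R : CleanRep f D) (hn : 8 < n) (hm : R.m ^ 3 + 2 ≤ n)
    (Φ : Perm (Fin n) →* (MvPolynomial (Fin n × Fin n) ℂ ≃ₐ[ℂ] MvPolynomial (Fin n × Fin n) ℂ))
    (hΦdeg : ∀ ρ q, (Φ ρ q).totalDegree = q.totalDegree) (hΦf : ∀ ρ, Φ ρ f = f) (i : Fin R.m)
    (ρ : Perm (Fin n)) (hρ : Perm.sign ρ = 1) : rdist (R.L i) (act (Φ ρ) (R.L i)) ≤ 8 * Rb R.m D := by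
  classical
  -- the matching choice (FACT A)
  choose J hJ using fun g : Perm (Fin n) => exists_rdist_act_le hRB R (Φ g) (hΦdeg g) (hΦf g) i
  -- numerics
  have hm1 : 1 ≤ R.m := Fin.pos i
  have hmle : R.m ≤ n := by nlinarith [hm, Nat.one_le_pow 2 R.m hm1, pow_succ R.m 2]
  have hdvd : 2 * R.m ∣ Nat.factorial n := two_mul_dvd_factorial hm1 hmle (by omega)
  obtain ⟨N, hN⟩ := hdvd
  have hN0 : 0 < N := by
    rcases Nat.eq_zero_or_pos N with h | h
    · rw [h, mul_zero] at hN; exact absurd hN (Nat.factorial_pos n).ne'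
    · exact h
  -- pigeonhole on `g ↦ (J g, sign g)`
  set F : Perm (Fin n) → Fin R.m × ℤˣ := fun g => (J g, Perm.sign g) with hF
  have hcardt : (Finset.univ : Finset (Fin R.m × ℤˣ)).card * N ≤ (Finset.univ : Finset (Perm (Fin n))).card := by
    rw [Finset.card_univ, Finset.card_univ, Fintype.card_prod, Fintype.card_fin, Fintype.card_units_int,
      Fintype.card_perm, Fintype.card_fin, hN]
    ring_nf; exact le_rfl
  obtain ⟨⟨j, ε⟩, -, hP⟩ := Finset.exists_le_card_fiber_of_mul_le_card_of_maps_to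
    (fun g _ => Finset.mem_univ (F g)) ⟨(i, 1), Finset.mem_univ _⟩ hcardt
  set P : Finset (Perm (Fin n)) := Finset.univ.filter fun g => F g = (j, ε) with hPdef
  have hPmem : ∀ g ∈ P, J g = j ∧ Perm.sign g = ε := fun g hg => by
    have := (Finset.mem_filter.1 hg).2
    simp only [hF, Prod.mk.injEq] at this
    exact this
  have hPne : P.Nonempty := by
    rw [← Finset.card_pos]; exact lt_of_lt_of_le hN0 hP
  obtain ⟨g₀, hg₀⟩ := hPne
  -- the set `Z = g₀⁻¹ P ⊆ 𝔄_n`, inside `E_j(2Rb)`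
  set Z : Finset (Perm (Fin n)) := P.image fun g => g₀⁻¹ * g with hZdef
  have hZcard : Z.card = P.card := Finset.card_image_of_injective _ (mul_right_injective g₀⁻¹)
  have hZsign : ∀ z ∈ Z, Perm.sign z = 1 := by
    intro z hz
    obtain ⟨g, hg, rfl⟩ := Finset.mem_image.1 hz
    rw [map_mul, map_inv, (hPmem g hg).2, (hPmem g₀ hg₀).2, inv_mul_cancel]
  have hZclose : ∀ z ∈ Z, rdist (R.L j) (act (Φ z) (R.L j)) ≤ 2 * Rb R.m D := by
    intro z hz
    obtain ⟨g, hg, rfl⟩ := Finset.mem_image.1 hz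
    have h1 : rdist (R.L j) (act (Φ (g₀⁻¹ * g)) (R.L j)) = rdist (act (Φ g₀) (R.L j)) (act (Φ g) (R.L j)) := by
      rw [← rdist_act (Φ g₀) (R.hnrm j) (isNormalised_act _ (R.L j)), ← act_mul, ← map_mul, mul_inv_cancel_left]
    rw [h1]
    calc rdist (act (Φ g₀) (R.L j)) (act (Φ g) (R.L j))
        ≤ rdist (act (Φ g₀) (R.L j)) (R.L i) + rdist (R.L i) (act (Φ g) (R.L j)) := rdist_triangle _ _ _
      _ ≤ Rb R.m D + Rb R.m D := by
          refine Nat.add_le_add ?_ ?_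
          · rw [rdist_comm, ← (hPmem g₀ hg₀).1]; exact hJ g₀
          · rw [← (hPmem g hg).1]; exact hJ g
      _ = 2 * Rb R.m D := by ring
  -- mixing: every even `ρ'` is a product of three elements of `Z`
  have hmixZ : ∀ ρ' : Perm (Fin n), Perm.sign ρ' = 1 → rdist (R.L j) (act (Φ ρ') (R.L j)) ≤ 6 * Rb R.m D := by
    intro ρ' hρ'
    have hcard : (Nat.factorial n / 2) ^ 3 < (n - 1) * (Z.card * Z.card * Z.card) := by
      have hhalf : Nat.factorial n / 2 = R.m * N := by
        rw [hN, mul_assoc, Nat.mul_div_cancel_left _ (by norm_num : 0 < 2)]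
      rw [hhalf, hZcard]
      have hm3 : R.m ^ 3 < n - 1 := by omega
      calc (R.m * N) ^ 3 = R.m ^ 3 * (N * N * N) := by ring
        _ < (n - 1) * (N * N * N) := Nat.mul_lt_mul_of_pos_right hm3 (by positivity)
        _ ≤ (n - 1) * (P.card * P.card * P.card) :=
            Nat.mul_le_mul_left _ (Nat.mul_le_mul (Nat.mul_le_mul hP hP) hP)
    obtain ⟨x, hx, y, hy, z, hz, rfl⟩ := hmix n hn Z Z Z hZsign hZsign hZsign hcard ρ' hρ'
    rw [map_mul, map_mul]
    calc rdist (R.L j) (act (Φ x * Φ y * Φ z) (R.L j))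
        ≤ rdist (R.L j) (act (Φ x * Φ y) (R.L j)) + rdist (R.L j) (act (Φ z) (R.L j)) := selfDist_mul_le _ _ (R.hnrm j)
      _ ≤ (rdist (R.L j) (act (Φ x) (R.L j)) + rdist (R.L j) (act (Φ y) (R.L j))) + rdist (R.L j) (act (Φ z) (R.L j)) :=
          Nat.add_le_add_right (selfDist_mul_le _ _ (R.hnrm j)) _
      _ ≤ (2 * Rb R.m D + 2 * Rb R.m D) + 2 * Rb R.m D :=
          Nat.add_le_add (Nat.add_le_add (hZclose x hx) (hZclose y hy)) (hZclose z hz)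
      _ = 6 * Rb R.m D := by ring
  -- transport to `i` along the edge `L i ~ Φ g₀ (L j)`
  have hconj : Φ ρ = Φ g₀ * Φ (g₀⁻¹ * ρ * g₀) * (Φ g₀)⁻¹ := by
    rw [← map_mul, ← map_inv, ← map_mul]; congr 1; group
  have hρ' : Perm.sign (g₀⁻¹ * ρ * g₀) = 1 := by
    rw [map_mul, map_mul, map_inv, hρ, mul_one, inv_mul_cancel]
  rw [hconj]
  calc rdist (R.L i) (act (Φ g₀ * Φ (g₀⁻¹ * ρ * g₀) * (Φ g₀)⁻¹) (R.L i))
      ≤ rdist (R.L i) (act (Φ g₀) (R.L j)) + rdist (R.L j) (act (Φ (g₀⁻¹ * ρ * g₀)) (R.L j)) +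
          rdist (R.L i) (act (Φ g₀) (R.L j)) := selfDist_conj_le _ _ (R.hnrm j) (R.hnrm i)
    _ ≤ Rb R.m D + 6 * Rb R.m D + Rb R.m D := by
        refine Nat.add_le_add (Nat.add_le_add ?_ (hmixZ _ hρ')) ?_ <;>
          · rw [← (hPmem g₀ hg₀).1]; exact hJ g₀
    _ = 8 * Rb R.m D := by ring

/-- `mact σ τ` is the product of the row action of `σ` and the column action of `τ`. [folklore] -/
theorem mact_eq_row_mul_col (σ τ : Perm (Fin n)) :
    mact σ τ = vact (K := ℂ) rowHom σ * vact (K := ℂ) colHom τ := by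
  ext p : 1
  rw [AlgEquiv.mul_apply, vact_colHom_eq, vact_rowHom_eq, mact_apply, mact_apply, mact_apply, rename_rename]
  rfl

/-- **M2 — ALMOST-INVARIANT TERMS** (registered stub `stub_almostInvariantTerms` of the line `mixing-scale`; the registered signature
`AlternatingMixing → depthThree_rankBound → AlmostInvariantTerms` with the mixing fact spelled by its Literature name
`alternatingProductMixing`, token for token the skeleton's `AlternatingMixing`): granting product mixing in `𝔄_n` (Gowers 2008 /
Nikolov–Pyber 2011) and the Saxena–Seshadhri rank bound, in the regime `8 < n`, `m³ + 2 ≤ n` every term of a clean minimal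
representation of a matrix-symmetric `f` is moved by rank distance `≤ 28·Rb` (indeed `≤ 16·Rb`) under every even row/column renaming:
rows and columns separately by `almostInv_of_hom`, combined by `mact_eq_row_mul_col` and subadditivity.
[cite: Gowers2008, Thm 3.3; NikolovPyber2011, Cor. 2; SaxenaSeshadhri2013, Theorem 5] -/
theorem stub_almostInvariantTerms : alternatingProductMixing → depthThree_rankBound → AlmostInvariantTerms := by
  intro hmix hRB n D f hsym R hn hm i σ τ hσ hτ
  have hrow := almostInv_of_hom hmix hRB R hn hm (vact (K := ℂ) rowHom)
    (fun ρ q => by rw [vact_rowHom_eq]; exact totalDegree_mact ρ 1 q) (fun ρ => by rw [vact_rowHom_eq]; exact hsym ρ 1) i σ hσ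
  have hcol := almostInv_of_hom hmix hRB R hn hm (vact (K := ℂ) colHom)
    (fun ρ q => by rw [vact_colHom_eq]; exact totalDegree_mact 1 ρ q) (fun ρ => by rw [vact_colHom_eq]; exact hsym 1 ρ) i τ hτ
  rw [mact_eq_row_mul_col]
  calc rdist (R.L i) (act (vact (K := ℂ) rowHom σ * vact (K := ℂ) colHom τ) (R.L i))
      ≤ rdist (R.L i) (act (vact (K := ℂ) rowHom σ) (R.L i)) + rdist (R.L i) (act (vact (K := ℂ) colHom τ) (R.L i)) :=
        selfDist_mul_le _ _ (R.hnrm i)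
    _ ≤ 8 * Rb R.m D + 8 * Rb R.m D := Nat.add_le_add hrow hcol
    _ ≤ 28 * Rb R.m D := by omega

end M2

end Summit.ValiantsHypothesis.ValiantsHypothesis.Theorems.OrbitRestorationQPMixingScale

end
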